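import Literature.IUT.HodgeArakelov.ConstantMultipleRigidityProofs
import Literature.IUT.HodgeArakelov.ThetaEvaluationSettingProofs2

/-!
# [IUTchII] Cor 1.12 (ii): the content input `(hθ₀)` REDUCED to the standard-type normalisation of the
# pointed inversion and the `ι`-invariant translates — second PROOF companion

Proof-only companion (abc-iut cell, D-0067 discharge wave 4, seat abc-iut-w4-d043 gen 2; SUBDAG
`plan/L6/SUBDAG-IUTchII-Cor-112.md` row **Cor-112.ii.r13**; node **IUTchII:Cor1.12(ii)**) to the landed
`ConstantMultipleRigidity.lean` (abc-iut-L6-t1 g2, v2 p410537, frozen) and `ConstantMultipleRigidityProofs.lean`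
(w4-d043, p411909 → v2 p412660). It reuses abc-iut-w4-d010's orbit/translate lemmas for [IUTchII] Prop. 2.2 (ii)
(`ThetaEvaluationSettingProofs2.lean`, p411925: `isOfFinAddOrder_iota_sub_iff_of_theta`,
`eq_zero_of_invariant_translate`) BY NAME. No definitions; no `Prop`-valued declaration; nothing of [EtTh] /
[IUTchII] is asserted.

S. Mochizuki, *Inter-universal Teichmüller theory II*, kurims manuscript (Dec. 2020), Cor. 1.12 (ii) p. 57
("restriction to the subgroup `D ⊆ Π_Ÿ(Π)` determines … `{M^×_TM·∞θ(Π)}^ι → M^×_TM(Π)` …; the inverse images of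
the submodules of torsion elements … are given … by `∞θ(Π)^ι`"), proof p. 58 ("Assertion (ii) follows
immediately from the structure of the objects under consideration, as described in [EtTh], Proposition 1.5,
(ii), (iii) [cf. also the proofs of [EtTh], Theorems 1.6, 1.10]"), Rmk. 1.4.1 (ii) p. 29 ("an “étale theta
function of standard type” is defined precisely by the condition that its restriction to `D_{μ_-}` be a `2l`-th
root of unity"), Prop. 2.2 (ii) p. 66 ("together with the condition of invariance with respect to `ι` [cf.
[EtTh], Proposition 1.4, (ii); the proof of [EtTh], Theorem 1.6, (iii)], determines a specific `μ_{2l}`-orbit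
`θ^ι(Π_v) ⊆ θ(Π_v)`"), Rmk. 2.1.1 (ii) p. 65 (the vertex labeled `0` is fixed by `ι`). Claim key `Mochizuki2012`,
status DISPUTED (D-0012). Nothing here bears on the disputed [IUTchIII] Cor. 3.12; typed ≠ discharged for the
inputs that remain binders.

WHAT IS PROVED. `ConstantMultipleRigidityProofs.lean` derives the typed `Cor112_ii Ev` from four printed inputs on
the theta-evaluation data `Ev : ThetaEvaluation T E I`, the content input being
`(hθ₀)` "every class of `θ(Π)` that is `ι`-invariant up to torsion restricts to a torsion element on `D`".
HERE `(hθ₀)` is DERIVED (`ThetaEvaluation.resD_toLim_theta_isOfFinAddOrder_of_translates`) from: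
* the `(l·ℤ) × μ₂`-DESCRIPTION of the orbit `η̈^{Θ,l·ℤ×μ₂}` relative to a family of translates `τ : ℤ → H¹`
  (`hdesc`: every orbit member is `τ n + c` with `2·c = 0` — [EtTh] Def. 2.7: deck translates of the standard
  class and the sign of `Θ̈`), `ι` REVERSING the translates up to torsion in the limit (`hrev`: [EtTh] Prop. 1.4
  (ii), [IUTchII] Rmk. 2.1.1 (i)/(ii) "`ι` reverses the `ℤ`-torsor of components") and distinct translates being
  non-torsion apart (`hfree`: [EtTh] Prop. 1.4 (i)/(iii), the divisor of poles) — the SAME binder shapes as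
  abc-iut-w4-d010's `prop22_ii'_of_translates` / `prop22_ii'_model` for node IUTchII:Prop2.2(ii) (here transported
  to the direct limit, where `Ev.iotaLim` acts);
* the STANDARD-TYPE NORMALISATION of the translate `τ 0`: its restriction to `D` is torsion (`hstd`) — which, when
  `τ 0` is the distinguished class `I.etaStd` of the pointed inversion `I : PointedInversion E T.D`, IS the landed
  FIELD `PointedInversion.standard : (2 * S.l) • I.resDmu I.etaStd = 0` (Rmk. 1.4.1 (ii) p. 29), granted the
  torsion-compatibility `hres` of the two restriction data `I.resDmu` (on `H¹`) and `Ev.resD ∘ toLim ⊤` (on the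
  limit) — both are "restriction to `D_{μ_-}`" at the model (`ThetaEvaluation.resD_toLim_etaStd_isOfFinAddOrder`).
Closing theorems: `ThetaEvaluation.cor112_ii_of_translates` (abstract `τ 0`), `ThetaEvaluation.cor112_ii_of_pointedInversion`
(`τ 0 = I.etaStd`: the field `PointedInversion.standard` is CONSUMED), `ThetaEvaluation.cor112_ii_of_translatesH1`
(the `ι`-action given on `H¹(Π_Ÿ(Π), (l·Δ_Θ)(Π))` by `ρ` compatible with `Ev.iotaLim`, `hrev`/`hfree` on `H¹` as
in `prop22_ii'_of_translates`, plus `hker` "the map to the limit reflects torsion" — PROVED at the model `Π^tp_X̲̲`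
in `IotaInvariantThetaInftyModel.lean`, where `toLim ⊤` is injective), and
`ThetaEvaluation.cor112_ii_of_iotaInvariantTheta'` (over a bad-place setting: the typed [IUTchII] Prop. 2.2 (ii)′
OUTPUT `Θ : IotaInvariantTheta' Dec` — its `μ_{2l}`-orbit clause `thetaIota_orbit` — with `Θ.iotaLim = Ev.iotaLim`,
`hker`, and `ι`-invariance of the standard class `I.etaStd` up to torsion, replaces `τ`/`hdesc`/`hrev`/`hfree`).
The remaining printed inputs `(hD₁)`/`(hD₂)` (also offered in SECTION form `hsec : res_D (incl m) = m`,
`ThetaEvaluation.cor112_ii_of_section_of_pointedInversion`), `(hι)`, `(hμ)` are the Kummer-theoretic facts about the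
unit classes `M^×_TM(Π)` (image of `O^×_{k̄}` under the Kummer map: [AbsTopIII] Prop. 3.2; at the model abc-iut-w4-d007's
`ModelMLFGaloisData.constantsKummerHom`, GAP-LEDGER G-w4d019-1) and stay binders here.
-/

namespace Literature.IUT.HodgeArakelov

universe u

variable {S : ThetaSetting.{u}} {F : ModelFamily S} {Sys : MonoThetaProjSystem F}
variable {T : ThetaEnvData Sys} {E : EnvOfGroup S Sys.PiX} {I : PointedInversion E T.D}

namespace ThetaEvaluation

variable {Ev : ThetaEvaluation T E I}

/-! ### The `ι`-invariant classes of `θ(Π)` are the standard ones, up to torsion -/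

/-- THE MECHANISM of "[EtTh], Proposition 1.5, (ii), (iii) [cf. also the proofs of [EtTh], Theorems 1.6, 1.10]"
as quoted in the proof of Cor. 1.12 (ii) (p. 58), at the level of the direct limit on which `ι` acts by
`Ev.iotaLim`: if the orbit `η̈^{Θ,l·ℤ×μ₂}` consists of the translates `τ n` of a class `τ 0` up to `2`-torsion
classes (`hdesc`), `ι` carries (the image in the limit of) `τ n` to that of `τ (-n)` up to torsion (`hrev`) and
distinct translates have non-torsion difference in the limit (`hfree`), then every class `t ∈ θ(Π)` whose image in
the limit is `ι`-invariant up to torsion is congruent to `-(τ 0)` modulo torsion there: `toLim t + toLim (τ 0)` has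
finite order. (`θ(Π)` = the `μ_l`-multiples of reciprocals of orbit members, `EtaleThetaData.theta_eq`; the vertex
labeled `0` is the one fixed by `ι`, Rmk. 2.1.1 (ii).) [claim: Mochizuki2012, status: disputed] (IUTchII §1 Cor 1.12 (ii), kurims pp.57-58) -/
theorem toLim_theta_add_isOfFinAddOrder_of_translates (τ : ℤ → T.D.coh.H1 ⊤)
    (hdesc : ∀ o ∈ T.D.orbit, ∃ (n : ℤ) (c : T.D.coh.H1 ⊤), 2 • c = 0 ∧ o = τ n + c)
    (hrev : ∀ n : ℤ,
      IsOfFinAddOrder (Ev.iotaLim (T.D.coh.toLim ⊤ (τ n)) - T.D.coh.toLim ⊤ (τ (-n))))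
    (hfree : ∀ m n : ℤ, IsOfFinAddOrder (T.D.coh.toLim ⊤ (τ m) - T.D.coh.toLim ⊤ (τ n)) → m = n)
    {t : T.D.coh.H1 ⊤} (ht : t ∈ T.D.theta)
    (hinv : IsOfFinAddOrder (Ev.iotaLim (T.D.coh.toLim ⊤ t) - T.D.coh.toLim ⊤ t)) :
    IsOfFinAddOrder (T.D.coh.toLim ⊤ t + T.D.coh.toLim ⊤ (τ 0)) := by
  have hl : 0 < S.l := S.l_prime.pos
  rw [T.D.theta_eq] at ht
  obtain ⟨o, ho, hlo⟩ := ht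
  obtain ⟨n, c, hc, rfl⟩ := hdesc o ho
  -- in the limit: `l • (toLim t + toLim (τ n + c)) = 0`
  have hlo' : S.l • (T.D.coh.toLim ⊤ t + T.D.coh.toLim ⊤ (τ n + c)) = 0 := by
    rw [← map_add, ← map_nsmul, hlo, map_zero]
  -- hence the orbit member is `ι`-invariant up to torsion as well
  have hio : IsOfFinAddOrder
      (Ev.iotaLim (T.D.coh.toLim ⊤ (τ n + c)) - T.D.coh.toLim ⊤ (τ n + c)) :=
    (isOfFinAddOrder_iota_sub_iff_of_theta Ev.iotaLim hl hlo').mp hinv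
  have hc' : 2 • T.D.coh.toLim ⊤ c = 0 := by rw [← map_nsmul, hc, map_zero]
  -- so its translate index is `0`
  have hn : n = 0 := by
    refine eq_zero_of_invariant_translate Ev.iotaLim (fun k => T.D.coh.toLim ⊤ (τ k)) hrev hfree hc' ?_
    simpa only [map_add] using hio
  subst hn
  -- `toLim t + toLim (τ 0) = (toLim t + toLim (τ 0 + c)) - toLim c`: `l`-torsion minus `2`-torsion
  have h1 : IsOfFinAddOrder (T.D.coh.toLim ⊤ t + T.D.coh.toLim ⊤ (τ 0 + c)) :=
    isOfFinAddOrder_iff_nsmul_eq_zero.mpr ⟨S.l, hl, hlo'⟩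
  have h2 : IsOfFinAddOrder (T.D.coh.toLim ⊤ c) :=
    isOfFinAddOrder_iff_nsmul_eq_zero.mpr ⟨2, two_pos, hc'⟩
  have hsplit : T.D.coh.toLim ⊤ t + T.D.coh.toLim ⊤ (τ 0) =
      (T.D.coh.toLim ⊤ t + T.D.coh.toLim ⊤ (τ 0 + c)) - T.D.coh.toLim ⊤ c := by
    rw [map_add]; abel
  rw [hsplit]
  exact ThetaValueOrbits.isOfFinAddOrder_sub h1 h2

/-- **The content input `(hθ₀)` of Cor. 1.12 (ii) DERIVED** from the translate description of the orbit
(`hdesc`, `hrev`, `hfree`, as above) and the STANDARD-TYPE NORMALISATION of the translate `τ 0`: "its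
restriction to `D_{μ_-}` [is] a `2l`-th root of unity" (Rmk. 1.4.1 (ii) p. 29) — here: `res_D (toLim (τ 0))` has
finite order (`hstd`). Conclusion: every `ι`-invariant-up-to-torsion class of `θ(Π)` restricts to a torsion element
on `D` — the hypothesis `(hθ₀)` of `cor112_ii_of_inputs_theta`. [claim: Mochizuki2012, status: disputed] (IUTchII §1 Cor 1.12 (ii), kurims pp.57-58) -/
theorem resD_toLim_theta_isOfFinAddOrder_of_translates (τ : ℤ → T.D.coh.H1 ⊤)
    (hdesc : ∀ o ∈ T.D.orbit, ∃ (n : ℤ) (c : T.D.coh.H1 ⊤), 2 • c = 0 ∧ o = τ n + c)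
    (hrev : ∀ n : ℤ,
      IsOfFinAddOrder (Ev.iotaLim (T.D.coh.toLim ⊤ (τ n)) - T.D.coh.toLim ⊤ (τ (-n))))
    (hfree : ∀ m n : ℤ, IsOfFinAddOrder (T.D.coh.toLim ⊤ (τ m) - T.D.coh.toLim ⊤ (τ n)) → m = n)
    (hstd : IsOfFinAddOrder (Ev.resD (T.D.coh.toLim ⊤ (τ 0)))) :
    ∀ t ∈ T.D.theta, IsOfFinAddOrder (Ev.iotaLim (T.D.coh.toLim ⊤ t) - T.D.coh.toLim ⊤ t) →
      IsOfFinAddOrder (Ev.resD (T.D.coh.toLim ⊤ t)) := by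
  intro t ht hinv
  have h := Ev.resD.isOfFinAddOrder
    (toLim_theta_add_isOfFinAddOrder_of_translates (Ev := Ev) τ hdesc hrev hfree ht hinv)
  rw [map_add] at h
  have hsplit : Ev.resD (T.D.coh.toLim ⊤ t) =
      (Ev.resD (T.D.coh.toLim ⊤ t) + Ev.resD (T.D.coh.toLim ⊤ (τ 0))) - Ev.resD (T.D.coh.toLim ⊤ (τ 0)) := by
    abel
  rw [hsplit]
  exact ThetaValueOrbits.isOfFinAddOrder_sub h hstd

/-! ### The standard-type normalisation from the pointed inversion `(ι, D)` -/

/-- The distinguished class `η_std` of the pointed inversion restricts to a torsion element on `D` — this IS the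
landed field `PointedInversion.standard` ("`(2·l) • resDmu etaStd = 0`": Rmk. 1.4.1 (ii) p. 29, "defined precisely
by the condition that its restriction to `D_{μ_-}` be a `2l`-th root of unity"), read through the theta-evaluation
datum `Ev.resD` on the limit, granted the torsion-compatibility `hres` of the two restriction data (`I.resDmu` on
`H¹(Π_Ÿ(Π), (l·Δ_Θ)(Π))`, `Ev.resD ∘ toLim ⊤`; at the model both are restriction to `D_{μ_-}`).
[claim: Mochizuki2012, status: disputed] (IUTchII §1 Rmk 1.4.1 (ii), kurims p.29) -/
theorem resD_toLim_etaStd_isOfFinAddOrder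
    (hres : ∀ x : T.D.coh.H1 ⊤, IsOfFinAddOrder (I.resDmu x) →
      IsOfFinAddOrder (Ev.resD (T.D.coh.toLim ⊤ x))) :
    IsOfFinAddOrder (Ev.resD (T.D.coh.toLim ⊤ I.etaStd)) :=
  hres _ (isOfFinAddOrder_iff_nsmul_eq_zero.mpr
    ⟨2 * S.l, Nat.mul_pos two_pos S.l_prime.pos, I.standard⟩)

/-! ### Closing theorems for `Cor112_ii Ev` -/

/-- **IUTchII:Cor1.12(ii)** (kurims p. 57) with the content input REDUCED to the translate description of the orbit
and the standard-type normalisation of `τ 0`: `Cor112_ii Ev` holds given `(hD₁)`/`(hD₂)` (unit classes restrict to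
unit classes, faithfully modulo torsion), `(hι)` (`ι` fixes unit classes up to torsion), `(hμ)` (torsion classes are
unit classes) — Kummer theory of the constants, [AbsTopIII] Prop. 3.2 — and `τ`, `hdesc`, `hrev`, `hfree`, `hstd`
as in `resD_toLim_theta_isOfFinAddOrder_of_translates`. [claim: Mochizuki2012, status: disputed] (IUTchII §1 Cor 1.12 (ii), kurims pp.57-58) -/
theorem cor112_ii_of_translates (hD₁ : ∀ m ∈ Ev.MxTM, Ev.resD (Ev.inclHd m) ∈ Ev.MxTM)
    (hD₂ : ∀ m ∈ Ev.MxTM, IsOfFinAddOrder (Ev.resD (Ev.inclHd m)) → IsOfFinAddOrder m)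
    (hι : ∀ m ∈ Ev.MxTM, IsOfFinAddOrder (Ev.iotaLim (Ev.inclHd m) - Ev.inclHd m))
    (hμ : ∀ y : Ev.Hd, IsOfFinAddOrder y → y ∈ Ev.MxTM)
    (τ : ℤ → T.D.coh.H1 ⊤)
    (hdesc : ∀ o ∈ T.D.orbit, ∃ (n : ℤ) (c : T.D.coh.H1 ⊤), 2 • c = 0 ∧ o = τ n + c)
    (hrev : ∀ n : ℤ,
      IsOfFinAddOrder (Ev.iotaLim (T.D.coh.toLim ⊤ (τ n)) - T.D.coh.toLim ⊤ (τ (-n))))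
    (hfree : ∀ m n : ℤ, IsOfFinAddOrder (T.D.coh.toLim ⊤ (τ m) - T.D.coh.toLim ⊤ (τ n)) → m = n)
    (hstd : IsOfFinAddOrder (Ev.resD (T.D.coh.toLim ⊤ (τ 0)))) :
    Literature.IUT.HodgeArakelov.Cor112_ii Ev :=
  cor112_ii_of_inputs_theta hD₁ hD₂ hι
    (resD_toLim_theta_isOfFinAddOrder_of_translates τ hdesc hrev hfree hstd) hμ

/-- **IUTchII:Cor1.12(ii)** (kurims p. 57) **from the pointed inversion**: as `cor112_ii_of_translates` with the
translates centred at the distinguished class of `I` (`τ 0 = I.etaStd`), so that the standard-type normalisation is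
the landed field `PointedInversion.standard` (Rmk. 1.4.1 (ii)) — consumed here — up to the torsion-compatibility
`hres` of the restriction data of `I` and `Ev`. Remaining binders: the Kummer-theoretic `(hD₁)`/`(hD₂)`/`(hι)`/`(hμ)`
and the [EtTh] Prop. 1.4 / Def. 2.7 description of the orbit by translates (`hdesc`, `hrev`, `hfree`) — the inputs
(R1)–(R3) of abc-iut-w4-d010's `prop22_ii'_model` for node IUTchII:Prop2.2(ii), in limit form.
[claim: Mochizuki2012, status: disputed] (IUTchII §1 Cor 1.12 (ii), kurims pp.57-58) -/
theorem cor112_ii_of_pointedInversion (hD₁ : ∀ m ∈ Ev.MxTM, Ev.resD (Ev.inclHd m) ∈ Ev.MxTM)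
    (hD₂ : ∀ m ∈ Ev.MxTM, IsOfFinAddOrder (Ev.resD (Ev.inclHd m)) → IsOfFinAddOrder m)
    (hι : ∀ m ∈ Ev.MxTM, IsOfFinAddOrder (Ev.iotaLim (Ev.inclHd m) - Ev.inclHd m))
    (hμ : ∀ y : Ev.Hd, IsOfFinAddOrder y → y ∈ Ev.MxTM)
    (τ : ℤ → T.D.coh.H1 ⊤) (hτ : τ 0 = I.etaStd)
    (hdesc : ∀ o ∈ T.D.orbit, ∃ (n : ℤ) (c : T.D.coh.H1 ⊤), 2 • c = 0 ∧ o = τ n + c)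
    (hrev : ∀ n : ℤ,
      IsOfFinAddOrder (Ev.iotaLim (T.D.coh.toLim ⊤ (τ n)) - T.D.coh.toLim ⊤ (τ (-n))))
    (hfree : ∀ m n : ℤ, IsOfFinAddOrder (T.D.coh.toLim ⊤ (τ m) - T.D.coh.toLim ⊤ (τ n)) → m = n)
    (hres : ∀ x : T.D.coh.H1 ⊤, IsOfFinAddOrder (I.resDmu x) →
      IsOfFinAddOrder (Ev.resD (T.D.coh.toLim ⊤ x))) :
    Literature.IUT.HodgeArakelov.Cor112_ii Ev :=
  cor112_ii_of_translates hD₁ hD₂ hι hμ τ hdesc hrev hfree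
    (hτ ▸ resD_toLim_etaStd_isOfFinAddOrder hres)

/-! ### Section form of the unit-class inputs -/

/-- SECTION FORM of `(hD₁)`/`(hD₂)` (abc-iut-w4-d041's remark, STATUS 2026-08-25T23:47:28Z): if restriction to
`D` is a left inverse of the inclusion on the unit classes — `res_D (incl m) = m` for `m ∈ M^×_TM(Π)` (at the
model: a Kummer class of a constant restricts, on the decomposition group `D ↠ G_k` of a `k`-rational point, to the
Kummer class of the same constant) — then `(hD₁)` and `(hD₂)` hold. [claim: Mochizuki2012, status: disputed] (IUTchII §1 Cor 1.12, kurims p.56) -/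
theorem hD_of_section (hsec : ∀ m ∈ Ev.MxTM, Ev.resD (Ev.inclHd m) = m) :
    (∀ m ∈ Ev.MxTM, Ev.resD (Ev.inclHd m) ∈ Ev.MxTM) ∧
      (∀ m ∈ Ev.MxTM, IsOfFinAddOrder (Ev.resD (Ev.inclHd m)) → IsOfFinAddOrder m) :=
  ⟨fun m hm => (hsec m hm).symm ▸ hm, fun m hm h => (hsec m hm) ▸ h⟩

/-- **IUTchII:Cor1.12(ii)** from the pointed inversion, with `(hD₁)`/`(hD₂)` in section form (`hsec`).
[claim: Mochizuki2012, status: disputed] (IUTchII §1 Cor 1.12 (ii), kurims pp.57-58) -/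
theorem cor112_ii_of_section_of_pointedInversion (hsec : ∀ m ∈ Ev.MxTM, Ev.resD (Ev.inclHd m) = m)
    (hι : ∀ m ∈ Ev.MxTM, IsOfFinAddOrder (Ev.iotaLim (Ev.inclHd m) - Ev.inclHd m))
    (hμ : ∀ y : Ev.Hd, IsOfFinAddOrder y → y ∈ Ev.MxTM)
    (τ : ℤ → T.D.coh.H1 ⊤) (hτ : τ 0 = I.etaStd)
    (hdesc : ∀ o ∈ T.D.orbit, ∃ (n : ℤ) (c : T.D.coh.H1 ⊤), 2 • c = 0 ∧ o = τ n + c)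
    (hrev : ∀ n : ℤ,
      IsOfFinAddOrder (Ev.iotaLim (T.D.coh.toLim ⊤ (τ n)) - T.D.coh.toLim ⊤ (τ (-n))))
    (hfree : ∀ m n : ℤ, IsOfFinAddOrder (T.D.coh.toLim ⊤ (τ m) - T.D.coh.toLim ⊤ (τ n)) → m = n)
    (hres : ∀ x : T.D.coh.H1 ⊤, IsOfFinAddOrder (I.resDmu x) →
      IsOfFinAddOrder (Ev.resD (T.D.coh.toLim ⊤ x))) :
    Literature.IUT.HodgeArakelov.Cor112_ii Ev :=
  cor112_ii_of_pointedInversion (hD_of_section hsec).1 (hD_of_section hsec).2 hι hμ τ hτ hdesc hrev hfree hres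

/-! ### The translate inputs given on `H¹(Π_Ÿ(Π), (l·Δ_Θ)(Π))` -/

/-- TRANSPORT TO THE LIMIT of the translate inputs stated on `H¹(Π_Ÿ(Π), (l·Δ_Θ)(Π))` with an `ι`-action `ρ`
there (EXACTLY the binders `ρ`, `hcompat`, `hrev`, `hfree` of abc-iut-w4-d010's `prop22_ii'_of_translates`), when
the map to the limit reflects torsion (`hker`; at the model `Π^tp_X̲̲` the map `toLim ⊤` is injective —
`IotaInvariantThetaInftyModel.lean`, inflation–restriction): `hrev` and `hfree` hold in the limit for `Ev.iotaLim`.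
[claim: Mochizuki2012, status: disputed] (IUTchII §1 Cor 1.12 (ii), kurims pp.57-58) -/
theorem translates_toLim_of_H1 (ρ : T.D.coh.H1 ⊤ ≃+ T.D.coh.H1 ⊤)
    (hcompat : ∀ x, T.D.coh.toLim ⊤ (ρ x) = Ev.iotaLim (T.D.coh.toLim ⊤ x))
    (hker : ∀ x : T.D.coh.H1 ⊤, IsOfFinAddOrder (T.D.coh.toLim ⊤ x) → IsOfFinAddOrder x)
    (τ : ℤ → T.D.coh.H1 ⊤) (hrev : ∀ n : ℤ, IsOfFinAddOrder (ρ (τ n) - τ (-n)))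
    (hfree : ∀ m n : ℤ, IsOfFinAddOrder (τ m - τ n) → m = n) :
    (∀ n : ℤ, IsOfFinAddOrder (Ev.iotaLim (T.D.coh.toLim ⊤ (τ n)) - T.D.coh.toLim ⊤ (τ (-n)))) ∧
      (∀ m n : ℤ, IsOfFinAddOrder (T.D.coh.toLim ⊤ (τ m) - T.D.coh.toLim ⊤ (τ n)) → m = n) := by
  refine ⟨fun n => ?_, fun m n h => hfree m n (hker _ ?_)⟩
  · rw [← hcompat, ← map_sub]
    exact (T.D.coh.toLim ⊤).isOfFinAddOrder (hrev n)
  · rwa [map_sub]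

/-- **IUTchII:Cor1.12(ii)** from the pointed inversion, translate inputs ON `H¹` (d010's binder shapes `ρ`,
`hcompat`, `τ`, `hdesc`, `hrev`, `hfree`) plus `hker` (the map to the limit reflects torsion — proved at the model).
[claim: Mochizuki2012, status: disputed] (IUTchII §1 Cor 1.12 (ii), kurims pp.57-58) -/
theorem cor112_ii_of_translatesH1 (hD₁ : ∀ m ∈ Ev.MxTM, Ev.resD (Ev.inclHd m) ∈ Ev.MxTM)
    (hD₂ : ∀ m ∈ Ev.MxTM, IsOfFinAddOrder (Ev.resD (Ev.inclHd m)) → IsOfFinAddOrder m)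
    (hι : ∀ m ∈ Ev.MxTM, IsOfFinAddOrder (Ev.iotaLim (Ev.inclHd m) - Ev.inclHd m))
    (hμ : ∀ y : Ev.Hd, IsOfFinAddOrder y → y ∈ Ev.MxTM)
    (ρ : T.D.coh.H1 ⊤ ≃+ T.D.coh.H1 ⊤)
    (hcompat : ∀ x, T.D.coh.toLim ⊤ (ρ x) = Ev.iotaLim (T.D.coh.toLim ⊤ x))
    (hker : ∀ x : T.D.coh.H1 ⊤, IsOfFinAddOrder (T.D.coh.toLim ⊤ x) → IsOfFinAddOrder x)
    (τ : ℤ → T.D.coh.H1 ⊤) (hτ : τ 0 = I.etaStd)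
    (hdesc : ∀ o ∈ T.D.orbit, ∃ (n : ℤ) (c : T.D.coh.H1 ⊤), 2 • c = 0 ∧ o = τ n + c)
    (hrev : ∀ n : ℤ, IsOfFinAddOrder (ρ (τ n) - τ (-n)))
    (hfree : ∀ m n : ℤ, IsOfFinAddOrder (τ m - τ n) → m = n)
    (hres : ∀ x : T.D.coh.H1 ⊤, IsOfFinAddOrder (I.resDmu x) →
      IsOfFinAddOrder (Ev.resD (T.D.coh.toLim ⊤ x))) :
    Literature.IUT.HodgeArakelov.Cor112_ii Ev :=
  cor112_ii_of_pointedInversion hD₁ hD₂ hι hμ τ hτ hdesc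
    (translates_toLim_of_H1 ρ hcompat hker τ hrev hfree).1
    (translates_toLim_of_H1 ρ hcompat hker τ hrev hfree).2 hres

end ThetaEvaluation

/-! ### From the typed [IUTchII] Prop. 2.2 (ii)′ output at a bad place -/

section BadPlace

variable {S' : BadPlaceSetting.{u}} {F' : ModelFamily S'.toThetaSetting} {Sys' : MonoThetaProjSystem F'}
variable {T' : ThetaEnvData Sys'} {E' : EnvOfGroup S'.toThetaSetting Sys'.PiX} {I' : PointedInversion E' T'.D}
variable {Ev : ThetaEvaluation T' E' I'}
variable {Tc : TemperedCoverings S' Sys'.PiX} {Dec : SubgraphDecomposition S' Tc T'.D}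

/-- **The content input `(hθ₀)` of Cor. 1.12 (ii) from the typed Prop. 2.2 (ii)′ output** (over a bad place `v`,
[IUTchII] §2): if `Θ : IotaInvariantTheta' Dec` (abc-iut-L6-t19's repair structure: the `ι`-invariants of `θ(Π_v)` up
to torsion form ONE `μ_{2l}`-orbit, `thetaIota_orbit`) acts on the limit by `Ev.iotaLim`, the map to the limit
reflects torsion (`hker`), and the distinguished class `η_std` of the pointed inversion is `ι`-invariant up to torsion
(`hιstd`: [EtTh] Prop. 1.4 (ii) at the class level — the vertex `0` is fixed by `ι`, Rmk. 2.1.1 (ii)) and restricts to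
torsion through `Ev.resD` (`hres` + the field `PointedInversion.standard`), then every `ι`-invariant-up-to-torsion
class of `θ(Π_v)` restricts to a torsion element on `D`. [claim: Mochizuki2012, status: disputed] (IUTchII §2 Prop 2.2 (ii), kurims p.66) -/
theorem ThetaEvaluation.resD_toLim_theta_isOfFinAddOrder_of_iotaInvariantTheta' (Θ : IotaInvariantTheta' Dec)
    (hΘ : ∀ x, Θ.iotaLim x = Ev.iotaLim x)
    (hker : ∀ x : T'.D.coh.H1 ⊤, IsOfFinAddOrder (T'.D.coh.toLim ⊤ x) → IsOfFinAddOrder x)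
    (hιstd : IsOfFinAddOrder (Θ.iotaH1 I'.etaStd - I'.etaStd))
    (hres : ∀ x : T'.D.coh.H1 ⊤, IsOfFinAddOrder (I'.resDmu x) →
      IsOfFinAddOrder (Ev.resD (T'.D.coh.toLim ⊤ x))) :
    ∀ t ∈ T'.D.theta, IsOfFinAddOrder (Ev.iotaLim (T'.D.coh.toLim ⊤ t) - T'.D.coh.toLim ⊤ t) →
      IsOfFinAddOrder (Ev.resD (T'.D.coh.toLim ⊤ t)) := by
  intro t ht hinv
  -- the standard class gives an `ι`-invariant member `-η_std ∈ θ(Π_v)`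
  have hstd_mem : -I'.etaStd ∈ T'.D.theta := T'.D.neg_mem_theta I'.etaStd_mem
  have hstd_inv : IsOfFinAddOrder (Θ.iotaH1 (-I'.etaStd) - -I'.etaStd) := by
    have h : Θ.iotaH1 (-I'.etaStd) - -I'.etaStd = -(Θ.iotaH1 I'.etaStd - I'.etaStd) := by
      rw [map_neg]; abel
    rw [h]
    exact hιstd.neg
  -- `t` is `ι`-invariant up to torsion on `H¹` (the limit map reflects torsion)
  have hinvH1 : IsOfFinAddOrder (Θ.iotaH1 t - t) := by
    refine hker _ ?_
    rw [map_sub, Θ.iota_compat, hΘ]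
    exact hinv
  -- the `μ_{2l}`-orbit clause: `(2·l) • (t - (-η_std)) = 0`
  have horb : (2 * S'.l) • (t - -I'.etaStd) = 0 :=
    Θ.thetaIota_orbit (-I'.etaStd) hstd_mem t ht hstd_inv hinvH1
  have hdiff : IsOfFinAddOrder (Ev.resD (T'.D.coh.toLim ⊤ (t - -I'.etaStd))) :=
    (Ev.resD.comp (T'.D.coh.toLim ⊤)).isOfFinAddOrder
      (isOfFinAddOrder_iff_nsmul_eq_zero.mpr ⟨2 * S'.l, Nat.mul_pos two_pos S'.l_prime.pos, horb⟩)
  have hstd : IsOfFinAddOrder (Ev.resD (T'.D.coh.toLim ⊤ I'.etaStd)) :=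
    ThetaEvaluation.resD_toLim_etaStd_isOfFinAddOrder hres
  -- `res_D (toLim t) = res_D (toLim (t + η_std)) - res_D (toLim η_std)`
  have hsplit : Ev.resD (T'.D.coh.toLim ⊤ t) =
      Ev.resD (T'.D.coh.toLim ⊤ (t - -I'.etaStd)) - Ev.resD (T'.D.coh.toLim ⊤ I'.etaStd) := by
    rw [sub_neg_eq_add, map_add, map_add, add_sub_cancel_right]
  rw [hsplit]
  exact ThetaValueOrbits.isOfFinAddOrder_sub hdiff hstd

/-- **IUTchII:Cor1.12(ii)** (kurims p. 57) at a bad place, **from the typed Prop. 2.2 (ii)′ output and the pointed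
inversion**: `Cor112_ii Ev` holds given the Kummer-theoretic unit-class inputs `(hD₁)`/`(hD₂)`/`(hι)`/`(hμ)`, a
Prop. 2.2 (ii)′ datum `Θ : IotaInvariantTheta' Dec` acting on the limit by `Ev.iotaLim`, `hker`, the `ι`-invariance
of the standard class up to torsion, and the torsion-compatibility `hres` of the restriction data (the standard-type
normalisation itself being the field `PointedInversion.standard`). [claim: Mochizuki2012, status: disputed] (IUTchII §1 Cor 1.12 (ii), kurims pp.57-58) -/
theorem ThetaEvaluation.cor112_ii_of_iotaInvariantTheta'
    (hD₁ : ∀ m ∈ Ev.MxTM, Ev.resD (Ev.inclHd m) ∈ Ev.MxTM)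
    (hD₂ : ∀ m ∈ Ev.MxTM, IsOfFinAddOrder (Ev.resD (Ev.inclHd m)) → IsOfFinAddOrder m)
    (hι : ∀ m ∈ Ev.MxTM, IsOfFinAddOrder (Ev.iotaLim (Ev.inclHd m) - Ev.inclHd m))
    (hμ : ∀ y : Ev.Hd, IsOfFinAddOrder y → y ∈ Ev.MxTM)
    (Θ : IotaInvariantTheta' Dec) (hΘ : ∀ x, Θ.iotaLim x = Ev.iotaLim x)
    (hker : ∀ x : T'.D.coh.H1 ⊤, IsOfFinAddOrder (T'.D.coh.toLim ⊤ x) → IsOfFinAddOrder x)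
    (hιstd : IsOfFinAddOrder (Θ.iotaH1 I'.etaStd - I'.etaStd))
    (hres : ∀ x : T'.D.coh.H1 ⊤, IsOfFinAddOrder (I'.resDmu x) →
      IsOfFinAddOrder (Ev.resD (T'.D.coh.toLim ⊤ x))) :
    Literature.IUT.HodgeArakelov.Cor112_ii Ev :=
  ThetaEvaluation.cor112_ii_of_inputs_theta hD₁ hD₂ hι
    (ThetaEvaluation.resD_toLim_theta_isOfFinAddOrder_of_iotaInvariantTheta' Θ hΘ hker hιstd hres) hμ

end BadPlace

end Literature.IUT.HodgeArakelov
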